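import Mathlib.Probability.ConditionalProbability
import Mathlib.Analysis.Convex.Extreme
import Literature.Probability.LatticeModels.GibbsSpecificationDLRProofs
import HarnessLib

/-!
# The tail σ-algebra of a lattice system; conditioning Gibbs measures on tail events

Topic `Probability/LatticeModels`, generic specifications `γ : Specification V S` (prelude
`GibbsSpecification`). First file of the infrastructure for the Aizenman–Higuchi theorem
(`GibbsStates.aizenman_higuchi`) along the percolation proof of Georgii–Higuchi, *Percolation and
number of phases in the two-dimensional Ising model*, J. Math. Phys. 41 (2000) 1153–1169, whose
§2 (p. 3 of arXiv:math/9907186) lists as background "the characterization of extremal Gibbs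
measures by their triviality on the tail σ-algebra `𝒯 = ⋂ {𝓕_{Λᶜ} : Λ ⊂ ℤ² finite}`" and whose
Cor. 3.2 uses "conditioning `μ` on any tail event `E` we obtain again a Gibbs measure"
(Georgii, *Gibbs Measures and Phase Transitions*, 2nd ed. 2011, Ch. 7, Thm. 7.7 and its proof).

## Contents (all proved, no named facts)

* `tailEvents V S` — the tail σ-algebra `𝒯 = ⨅_Λ 𝓕_{Λᶜ}` on `V → S` (`cylinderEvents` of
  Mathlib for the outside σ-algebras), `tailEvents_le_cylinderEvents`, `measurableSet_tailEvents_iff`.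
* `IsTailTrivial μ` — every tail event has `μ`-probability `0` or `1`.
* `IsGibbsMeasure.cond` — if `μ ∈ 𝒢(γ)` and `B ∈ 𝓕_{Λᶜ}` for every finite `Λ` (in particular
  `B ∈ 𝒯`) with `μ B ≠ 0`, then the conditioned measure `μ[·|B]` (Mathlib `ProbabilityTheory.cond`)
  is again in `𝒢(γ)`: `∫ γ_Λ(A|η) μ[dη|B] = μ(B)⁻¹ ∫_B γ_Λ(A|·) dμ = μ(B)⁻¹ ∫ γ_Λ(A ∩ B|·) dμ
  = μ(A ∩ B)/μ(B)` by properness (`IsSpecification.measure_inter_of_cylinderEvents`) and DLR.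
* `measure_smul_cond_add_compl` — `μ = μ(B) μ[·|B] + μ(Bᶜ) μ[·|Bᶜ]` as measures.
* `IsExtremalGibbs.isTailTrivial` — an extremal Gibbs measure is tail trivial (the direction
  (a) ⇒ (b) of Georgii 2011, Thm. 7.7): otherwise the displayed decomposition along a tail event
  `B` with `0 < μ(B) < 1` writes `μ` as a proper convex combination of the two distinct Gibbs
  measures `μ[·|B] ≠ μ[·|Bᶜ]`.

The converse direction (tail trivial ⇒ extremal) and the extremal decomposition are not in this
file.

## Mathlib

`MeasureTheory.cylinderEvents`, `ProbabilityTheory.cond` (`μ[|s]`, `cond_apply`,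
`cond_isProbabilityMeasure`), `Set.extremePoints` / `openSegment` over `ℝ≥0∞` (as in
`IsExtremalGibbs`), `Measure.restrict_add_restrict_compl`. Mathlib has no tail σ-algebra of a
product space as a named object (its Kolmogorov 0–1 law is phrased with `Filter.limsup` of
σ-algebras) and no Gibbs measures.

## References

* H.-O. Georgii, Y. Higuchi, J. Math. Phys. 41 (2000) 1153–1169, §2 (p. 3) and proof of Cor. 3.2
  (p. 8) [GeorgiiHiguchi2000].
* H.-O. Georgii, *Gibbs Measures and Phase Transitions*, 2nd ed., de Gruyter 2011, §7.1,
  Thm. 7.7 [Georgii2011].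
-/

noncomputable section

open MeasureTheory ProbabilityTheory
open scoped ENNReal ProbabilityTheory

namespace Literature.Probability.LatticeModels

variable {V S : Type*} [MeasurableSpace S]

/-! ### The tail σ-algebra -/

variable (V S) in
/-- The **tail σ-algebra** `𝒯 = ⋂ {𝓕_{Λᶜ} : Λ ⊂ V finite}` of the configuration space `V → S`:
the events which do not depend on the spins in any finite region (Georgii–Higuchi 2000, §2, p. 3;
Georgii 2011, §7.1). Here `𝓕_{Λᶜ} = cylinderEvents (↑Λ)ᶜ`. [cite: GeorgiiHiguchi2000, §2 p. 3] -/
@[implicit_reducible]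
def tailEvents : MeasurableSpace (V → S) :=
  ⨅ Λ : Finset V, cylinderEvents (X := fun _ : V => S) ((↑Λ : Set V)ᶜ)

/-- `𝒯 ≤ 𝓕_{Λᶜ}` for every finite `Λ` (Georgii–Higuchi 2000, §2, p. 3). [cite: GeorgiiHiguchi2000, §2 p. 3] -/
theorem tailEvents_le_cylinderEvents (Λ : Finset V) :
    tailEvents V S ≤ cylinderEvents (X := fun _ : V => S) ((↑Λ : Set V)ᶜ) :=
  iInf_le _ Λ

/-- `𝒯` is a sub-σ-algebra of the product σ-algebra. [cite: GeorgiiHiguchi2000, §2 p. 3] -/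
theorem tailEvents_le_pi : tailEvents V S ≤ (MeasurableSpace.pi : MeasurableSpace (V → S)) :=
  (tailEvents_le_cylinderEvents (∅ : Finset V)).trans cylinderEvents_le_pi

/-- A set is a tail event iff it belongs to `𝓕_{Λᶜ}` for every finite `Λ`
(Georgii–Higuchi 2000, §2, p. 3: `𝒯 = ⋂ {𝓕_{Λᶜ}}`). [cite: GeorgiiHiguchi2000, §2 p. 3] -/
theorem measurableSet_tailEvents_iff {B : Set (V → S)} :
    MeasurableSet[tailEvents V S] B ↔
      ∀ Λ : Finset V, MeasurableSet[cylinderEvents (X := fun _ : V => S) ((↑Λ : Set V)ᶜ)] B :=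
  MeasurableSpace.measurableSet_iInf

/-- A tail event is measurable for the product σ-algebra. [cite: GeorgiiHiguchi2000, §2 p. 3] -/
theorem MeasurableSet.of_tailEvents {B : Set (V → S)} (hB : MeasurableSet[tailEvents V S] B) :
    MeasurableSet B :=
  tailEvents_le_pi _ hB

/-- **Tail triviality**: `μ` is trivial on the tail σ-algebra, `μ(B) ∈ {0, 1}` for every
`B ∈ 𝒯` — for Gibbs measures the characterisation of extremality (Georgii–Higuchi 2000, §2,
p. 3; Georgii 2011, Thm. 7.7). [cite: GeorgiiHiguchi2000, §2 p. 3] -/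
def IsTailTrivial (μ : Measure (V → S)) : Prop :=
  ∀ B : Set (V → S), MeasurableSet[tailEvents V S] B → μ B = 0 ∨ μ B = 1

/-! ### Conditioning on events measurable at infinity -/

/-- `μ = μ(B) μ[·|B] + μ(Bᶜ) μ[·|Bᶜ]` as measures, for a finite measure and a measurable `B`
(the decomposition used in the proof of Georgii 2011, Thm. 7.7, (a) ⇒ (b); when `μ(B) = 0` the
term `μ(B) μ[·|B]` is `0`). [cite: Georgii2011, Thm. 7.7] -/
theorem measure_smul_cond_add_compl {Ω : Type*} [MeasurableSpace Ω] (μ : Measure Ω)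
    [IsFiniteMeasure μ] {B : Set Ω} (hB : MeasurableSet B) :
    μ B • μ[|B] + μ Bᶜ • μ[|Bᶜ] = μ := by
  have key : ∀ s : Set Ω, μ s • μ[|s] = μ.restrict s := by
    intro s
    by_cases hs : μ s = 0
    · rw [hs, zero_smul, Measure.restrict_eq_zero.2 hs]
    · rw [ProbabilityTheory.cond, smul_smul, ENNReal.mul_inv_cancel hs (measure_ne_top μ s),
        one_smul]
  rw [key, key, Measure.restrict_add_restrict_compl hB]

variable {γ : Specification V S} {μ : Measure (V → S)}

/-- **Conditioning a Gibbs measure on an event at infinity gives a Gibbs measure**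
(Georgii–Higuchi 2000, proof of Cor. 3.2, p. 8: "conditioning `μ` on any tail event we obtain
again a Gibbs measure"; Georgii 2011, proof of Thm. 7.7): if `μ ∈ 𝒢(γ)`, `B ∈ 𝓕_{Λᶜ}` for every
finite `Λ` and `μ(B) ≠ 0`, then `μ[·|B] ∈ 𝒢(γ)`. Indeed
`∫ γ_Λ(A|·) dμ[·|B] = μ(B)⁻¹ ∫_B γ_Λ(A|·) dμ = μ(B)⁻¹ ∫ γ_Λ(A ∩ B|·) dμ = μ(A ∩ B)/μ(B)` by
properness of `γ_Λ` for `B ∈ 𝓕_{Λᶜ}` and the DLR equation for `A ∩ B`. [cite: GeorgiiHiguchi2000, Cor. 3.2 (proof, p. 8)] -/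
theorem IsGibbsMeasure.cond (hγ : IsSpecification γ) (hμ : IsGibbsMeasure γ μ) {B : Set (V → S)}
    (hB : ∀ Λ : Finset V, MeasurableSet[cylinderEvents (X := fun _ : V => S) ((↑Λ : Set V)ᶜ)] B)
    (hμB : μ B ≠ 0) : IsGibbsMeasure γ (μ[|B]) := by
  haveI := hμ.isProbabilityMeasure
  have hBm : MeasurableSet B := cylinderEvents_le_pi _ (hB ∅)
  refine ⟨cond_isProbabilityMeasure hμB, fun Λ A hA => ?_⟩
  -- `∫_B γ_Λ(A|·) dμ = ∫ γ_Λ(A ∩ B|·) dμ = μ(A ∩ B)`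
  have hind : ∀ η, B.indicator (fun η => γ Λ η A) η = γ Λ η (A ∩ B) := by
    intro η
    rw [hγ.measure_inter_of_cylinderEvents Λ A (hB Λ) η]
    by_cases hη : η ∈ B
    · simp [Set.indicator_of_mem hη]
    · simp [Set.indicator_of_notMem hη]
  have hset : ∫⁻ η in B, γ Λ η A ∂μ = μ (A ∩ B) := by
    rw [← lintegral_indicator hBm]
    simp_rw [hind]
    exact hμ.2 Λ (A ∩ B) (hA.inter hBm)
  rw [ProbabilityTheory.cond, lintegral_smul_measure, hset, Measure.smul_apply,
    Measure.restrict_apply hA, smul_eq_mul]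

/-- **Conditioning a Gibbs measure on a tail event of positive probability gives a Gibbs
measure** (Georgii–Higuchi 2000, proof of Cor. 3.2, p. 8; Georgii 2011, proof of Thm. 7.7). [cite: GeorgiiHiguchi2000, Cor. 3.2 (proof, p. 8)] -/
theorem IsGibbsMeasure.cond_of_tailEvents (hγ : IsSpecification γ) (hμ : IsGibbsMeasure γ μ)
    {B : Set (V → S)} (hB : MeasurableSet[tailEvents V S] B) (hμB : μ B ≠ 0) :
    IsGibbsMeasure γ (μ[|B]) :=
  hμ.cond hγ (measurableSet_tailEvents_iff.1 hB) hμB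

/-! ### Extremal Gibbs measures are tail trivial -/

/-- **An extremal Gibbs measure is trivial on the tail σ-algebra** (Georgii 2011, Thm. 7.7,
(a) ⇒ (b); Georgii–Higuchi 2000, §2, p. 3). If `B ∈ 𝒯` had `0 < μ(B) < 1`, then
`μ = μ(B) μ[·|B] + μ(Bᶜ) μ[·|Bᶜ]` would exhibit `μ` as a proper convex combination of two Gibbs
measures (`IsGibbsMeasure.cond_of_tailEvents`), so extremality forces `μ[·|B] = μ`, whence
`μ(B) = μ[B|B] = 1`, a contradiction. [cite: Georgii2011, Thm. 7.7] -/
theorem IsExtremalGibbs.isTailTrivial (hγ : IsSpecification γ) (hμ : IsExtremalGibbs γ μ) :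
    IsTailTrivial μ := by
  obtain ⟨hμG, hext⟩ := hμ
  have hμG' : IsGibbsMeasure γ μ := hμG
  haveI := hμG'.isProbabilityMeasure
  intro B hB
  by_contra h
  have hB0 : μ B ≠ 0 := fun h0 => h (Or.inl h0)
  have hB1 : μ B ≠ 1 := fun h1 => h (Or.inr h1)
  have hBm : MeasurableSet B := MeasurableSet.of_tailEvents hB
  have hBc0 : μ Bᶜ ≠ 0 := by
    rw [prob_compl_eq_one_sub hBm]
    exact fun h0 => hB1 (le_antisymm prob_le_one (tsub_eq_zero_iff_le.1 h0))
  have h1 : IsGibbsMeasure γ (μ[|B]) := hμG'.cond_of_tailEvents hγ hB hB0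
  have h2 : IsGibbsMeasure γ (μ[|Bᶜ]) := by
    refine hμG'.cond hγ (fun Λ => ?_) hBc0
    exact (measurableSet_tailEvents_iff.1 hB Λ).compl
  have hseg : μ ∈ openSegment ℝ≥0∞ (μ[|B]) (μ[|Bᶜ]) :=
    ⟨μ B, μ Bᶜ, pos_iff_ne_zero.2 hB0, pos_iff_ne_zero.2 hBc0, prob_add_prob_compl hBm,
      measure_smul_cond_add_compl μ hBm⟩
  have hEq : μ[|B] = μ := hext h1 h2 hseg
  have hBB : μ[|B] B = 1 := cond_apply_self hB0 (measure_ne_top μ B)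
  rw [hEq] at hBB
  exact hB1 hBB

end Literature.Probability.LatticeModels
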